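import Summits.QuantumFields.Balaban3D.Proofs.AlphaAC
import Literature.MathematicalPhysics.QuantumFieldTheory.Balaban1983to89.T3RestrictedUnitDensity
import HarnessLib

/-!
# `AlphaInputsT3AC` — Bałaban's (α) input package READ AT THE T³ OBJECTS: the averaging PINNED to the block averaging `blockAvg ℰp` of the
# family `T3Family.P K`, Haar compatibility WEAKENED to absolute continuity (a tree theorem for that averaging), masses the exact transports

Definition request `defn-AlphaInputsT3AC` of route `UnitScaleTilt` (cell ym3-torus, rung R3; cruxes `HistoryTail` stmt-QuantumFields-18916 and
`FluctuationComparisonRegPr` stmt-QuantumFields-19201), owner ruling 2026-08-26 (pub/ym3-torus STATUS 11:16:48Z, 12:34:01Z).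

WHY A SECOND PACKAGE.  The package of record `AlphaInputs3D.AtScale L` (this directory, p410587) ∃-binds print's external inputs
`X : Carriers.ExternalInputs S G`, whose block averaging `X.av` is FREE data carrying EXACT Haar compatibility `av_map : Ū_*(dU) = dV`; the two
cruxes are pinned (through `T3UnitScaleTilt.histGood` / `gibbsK`) to the block averaging `BlockAveraging.blockAvg ℰp` of [Balaban1987RG1] (0.4) at
the printed smearing `ℰp = expMeanLogSU`, for which exact Haar compatibility is NOT in print ([Balaban1985Averaging] (10) p. 19 is the V-integral
normalisation only), NOT in the tree (absolute continuity only: `T3UnitLawDensityEML.haarAC_blockAvg`) and false beyond forests for non-abelian `G`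
(cell ym-nodeO-ideate reading) — so after ∃-elimination nothing related `X.av` to the cruxes' averaging (`AtScale L` was IDLE, fleet finding
af2a5b6fdc02c5ee), and pinning `X.av := blockAvg ℰp` inside `ExternalInputs` would make the package possibly VACUOUS.  The lane pub-balaban3d
(seat alpha-1) re-derived its carrier stack over `Carriers.AvgAC` with UNCAPPED Radon–Nikodym masses (`Balaban3D/Proofs/{TransportAC, MassesAC,
TowerAC, SeriesAC, StandardAC, Bound55AC, InputsAC, AlphaAC}`; finding F-α1-1: any `[0,1]`-pinned masses force exact Haar-ness through the step
leaf's `hm₁`), and THIS FILE pins that AC package to the T³ objects: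

* `T3Scales F γ hγ hγ1 K : Scales F.L` — the `K`-th approximation of the family at dimensionless coupling `γ ∈ (0,1]` as the lane's numeric
  data (`ε := L^{−K}`, `ε₀ := 1`, `g := √γ`, so `g₀² = γ·ε_K = β_K⁻¹` of `T3UnitScaleTilt.gibbsK` and `(T3Scales …).P = F.P K` BY `rfl`);
* `avT3 F K` — THE PINNED AVERAGING FAMILY: `blockAvg ℰp` at every level of the standing range `j + 1 ≤ m + K` (LQB's axial `stdAvg` beyond,
  never met for `k ≤ K`), with `Carriers.AvgAC` a THEOREM (`avgAC_avT3`: tree `measurable_blockAvg` + `haarAC_blockAvg`) and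
  `Averaging.iter (avT3 F K) k = Averaging.iter (fun _ => blockAvg ℰp) k` (`iter_avT3`: the cruxes' iterated averages);
* `XT3 … reg Uk UkH hUkH : ExternalInputsAC (T3Scales …) SU(2)` — the AC external inputs with THAT averaging and given minimizer data
  (`reg`, `U_k`, `U_k(·,h)` of [Balaban1985Variational] Thm 1 / (42) stay ∃-bound, as in `AlphaInputs3D`: `HistoryTailAt` pins no minimizer and
  the route has only minimal VALUES, `T3PrintedRegularMinimiser.minActionRegPr`; a bridge row can be added by the consumer of 19201);
* `AlphaInputsT3AC.Of F 𝔠` — for ONE family and ONE constants record `𝔠 : Primitives.AlphaConsts F.L 2` (group `SU(2)` with the lane's model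
  `Carriers.suGroupModel 2`): for every `γ ∈ (0, (min 𝔠.γ₀ 1)²]` and every `K` there are minimizer data, expansion data `𝔖` (chart values in
  `𝔰𝔲(2)ᶜ`) and auxiliary data `𝔄` such that the AC (α) rows `AlphaAC.RunAlphaAC` hold — the lane's 31 countersigned rows read at the AC tower
  of `XT3` (HYPOTHESIS SCHEMA, never asserted);
* `AlphaInputsT3AC L := ∃ 𝔠 : AlphaConsts L 2, ∀ F, F.L = L → AlphaInputsT3AC.Of F (▸𝔠)` — the closed `Prop` a route item names;
* API: `T3Scales_P`, `T3Scales_g0sq_eq`, `avT3_of_le`, `avgAC_avT3`, `iter_avT3`, `XT3_av`, **`rho_towerOfAC_ae_eq_towerDensity`** (the AC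
  tower's densities ARE, `dV`-a.e., the T³ cell's Radon–Nikodym tower `T3RestrictedUnitDensity.towerDensity` from the Wilson start
  `e^{−E}·e^{−β_K A}` — the identification that makes the socket load-bearing for the cruxes), `wilsonStart_T3_eq`.
The FEED (Theorem 2 = (41) ∧ (47) of [Balaban1985UV3] for the pinned AC tower from `RunAlphaAC`) is `Balaban3D/Proofs/Thm2AC` (lane
pub-balaban3d), appended to this API as it lands.  Nothing is asserted here.  WHAT THIS IS NOT: not d = 4, not a continuum limit, not a
statement about expectations, not a claim that the (α) rows hold for `blockAvg ℰp`.

References: T. Bałaban, Commun. Math. Phys. 102 (1985) 255–275 [Balaban1985UV3] (Thm 1 p.257, Thm 2 p.272, (41) p.266, (47) p.267, (71) p.273);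
Commun. Math. Phys. 98 (1985) 17–51 [Balaban1985Averaging] ((10), (15) p.19); Commun. Math. Phys. 109 (1987) 249–301 [Balaban1987RG1] ((0.4) p.253).
-/

set_option autoImplicit false

noncomputable section

namespace Summit.QuantumFields.YangMills.Theorems

open MeasureTheory
open Literature.MathematicalPhysics.QuantumFieldTheory.Balaban1983to89
open Literature.MathematicalPhysics.QuantumFieldTheory.Balaban1983to89.T3ContinuumYM3Torus
open Literature.MathematicalPhysics.QuantumFieldTheory.Balaban1983to89.T3UnitLawDensityEML
  (ℰp measurableE_ℰp measurable_blockAvg haarAC_blockAvg)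
open Literature.MathematicalPhysics.QuantumFieldTheory.Balaban1983to89.T3RestrictedUnitDensity (towerDensity towerDensity_succ)
open Literature.MathematicalPhysics.QuantumFieldTheory.Balaban1983to89.Missing (boltzmann)
open Literature.MathematicalPhysics.QuantumFieldTheory.Balaban1985CMP102
open Literature.MathematicalPhysics.QuantumFieldTheory.Balaban1985CMP102.Setting
open Summit.QuantumFields.Balaban3D.Carriers
open Summit.QuantumFields.Balaban3D.Proofs.Primitives
open Summit.QuantumFields.Balaban3D.Proofs.GroupModelLieC (lieC)
open Summit.QuantumFields.Balaban3D.Proofs.TowerAC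
open Summit.QuantumFields.Balaban3D.Proofs.StandardAC
open Summit.QuantumFields.Balaban3D.Proofs.InputsAC
open Summit.QuantumFields.Balaban3D.Proofs.AlphaAC

/-! ## §1 The T³ approximation as the lane's numeric data -/

/-- **THE `K`-TH APPROXIMATION OF THE FAMILY `F` AT DIMENSIONLESS COUPLING `γ ∈ (0,1]` AS A `Scales F.L`**: block size `F.L`, volume exponent `F.m`,
`K` steps, lattice spacing `ε = L^{−K}` (`Setup.Params.eps`), terminal spacing `ε₀ = 1` (the unit lattice is the top of every T³ approximation),
coupling `g = √γ` — so that `g₀² = g²ε = γ·ε_K` is the inverse of the Gibbs weight `β_K` of `T3UnitScaleTilt.gibbsK` ([Balaban1985UV3] (1) «g₀² = g²ε»)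
and the standing smallness `g²ε₀ = γ ≤ 1`. [cite: Balaban1985UV3, (1)–(2) p.256] -/
def T3Scales (F : T3Family) (γ : ℝ) (hγ : 0 < γ) (hγ1 : γ ≤ 1) (K : ℕ) : Scales F.L where
  hL := F.hL
  m := F.m
  K := K
  ε := ((F.L : ℝ)⁻¹) ^ K
  ε_pos := by
    have hL : (0 : ℝ) < F.L := by exact_mod_cast (zero_lt_one.trans F.hL.2)
    positivity
  ε₀ := 1
  hK := by
    have hL : (F.L : ℝ) ≠ 0 := by exact_mod_cast (zero_lt_one.trans F.hL.2).ne'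
    rw [inv_pow, mul_inv_cancel₀ (pow_ne_zero K hL)]
  g := Real.sqrt γ
  g_pos := Real.sqrt_pos.2 hγ
  gK_le_one := by rw [Real.sq_sqrt hγ.le, mul_one]; exact hγ1

variable (F : T3Family) (γ : ℝ) (hγ : 0 < γ) (hγ1 : γ ≤ 1) (K : ℕ)

/-- The lattice parameters of `T3Scales F γ … K` ARE the family's `F.P K` (definitional). [cite: Balaban1985UV3, (1)–(2) p.256] -/
theorem T3Scales_P : (T3Scales F γ hγ hγ1 K).P = F.P K := rfl

/-- `g₀² = γ·ε_K` for `T3Scales` — the inverse of the Gibbs weight `β_K = (γε_K)⁻¹` of the family's scheme (`T3Family.scheme`). [cite: Balaban1985UV3, (1) p.256] -/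
theorem T3Scales_g0sq_eq : (T3Scales F γ hγ hγ1 K).g0sq = γ * (F.P K).eps := by
  show Real.sqrt γ ^ 2 * ((F.L : ℝ)⁻¹) ^ K = γ * ((F.L : ℝ)⁻¹) ^ K
  rw [Real.sq_sqrt hγ.le]

/-- `1/g₀² = β_K`: the lane's Wilson start and the family's Gibbs weight have the same inverse coupling. [cite: Balaban1985UV3, (1) p.256] -/
theorem T3Scales_inv_g0sq_eq : 1 / (T3Scales F γ hγ hγ1 K).g0sq = (F.scheme ℰp γ).β K := by
  rw [T3Scales_g0sq_eq, one_div]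
  rfl

/-! ## §2 The pinned averaging family and the pinned AC external inputs -/

/-- **THE PINNED AVERAGING FAMILY**: the block averaging `blockAvg ℰp` of the family ([Balaban1987RG1] (0.4) at the printed smearing) at every level
of the standing range `j + 1 ≤ m + K`; LQB's total axial family `AveragingRT.stdAvg` beyond (a relabelling never met for `k ≤ K`, needed only to make
the family total). [cite: Balaban1987RG1, (0.4) p.253] -/
def avT3 (j : ℕ) : Averaging (F.P K) j (Matrix.specialUnitaryGroup (Fin 2) ℂ) :=
  if j + 1 ≤ F.m + K then BlockAveraging.blockAvg (P := F.P K) (j := j) ℰp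
  else AveragingRT.stdAvg (F.P K) (Matrix.specialUnitaryGroup (Fin 2) ℂ) j

/-- In the standing range the pinned averaging IS `blockAvg ℰp`. [cite: Balaban1987RG1, (0.4) p.253] -/
theorem avT3_of_le {j : ℕ} (hj : j + 1 ≤ F.m + K) :
    avT3 F K j = BlockAveraging.blockAvg (P := F.P K) (j := j) ℰp := by
  unfold avT3; rw [if_pos hj]

/-- **`AvgAC` FOR THE PINNED AVERAGING IS A THEOREM** at every level: measurability + absolute continuity of the push-forward of product Haar
(tree `T3UnitLawDensityEML.measurable_blockAvg`/`haarAC_blockAvg` ⇐ `BlockAveragingEMLHaarAC`; LQB `avgAC_stdAvg` beyond the range).  No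
hypothesis on the averaging enters the package. [cite: Balaban1985Averaging, (10) p.19] -/
theorem avgAC_avT3 (j : ℕ) : AvgAC (avT3 F K j).avg := by
  unfold avT3
  by_cases hj : j + 1 ≤ F.m + K
  · rw [if_pos hj]; exact ⟨measurable_blockAvg F K j, haarAC_blockAvg F K hj⟩
  · rw [if_neg hj]; exact avgAC_stdAvg j

/-- **The iterated pinned averaging IS the cruxes' iterated block averaging** `Averaging.iter (fun _ => blockAvg ℰp) k` for `k ≤ m + K` (the map
inside `T3UnitScaleTilt.histGood`, `unitA`, `T3RestrictedUnitDensity.towerDensity`). [cite: Balaban1987RG1, (0.4) p.253] -/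
theorem iter_avT3 : ∀ k : ℕ, k ≤ F.m + K →
    Averaging.iter (avT3 F K) k =
      Averaging.iter (fun j => BlockAveraging.blockAvg (P := F.P K) (j := j) ℰp) k
  | 0, _ => rfl
  | k + 1, hk => by
    show (avT3 F K k).avg ∘ Averaging.iter (avT3 F K) k =
      (BlockAveraging.blockAvg (P := F.P K) (j := k) ℰp).avg ∘ Averaging.iter (fun j => BlockAveraging.blockAvg ℰp) k
    rw [iter_avT3 k (by omega), avT3_of_le F K hk]

/-- **THE PINNED AC EXTERNAL INPUTS** of the `K`-th approximation: averaging := `avT3 F K` (its `AvgAC` the theorem `avgAC_avT3`), regular classes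
and minimizers `reg`, `U_k`, `U_k(·,h)` given ([Balaban1985Variational] Thm 1 / [Balaban1985UV3] (42): external constructions, binder b11).
[cite: Balaban1985UV3, (2) p.256 + (42) p.266] -/
def XT3 (reg : ℕ → Set (GaugeField (F.P K) 0 (Matrix.specialUnitaryGroup (Fin 2) ℂ)))
    (Uk : (k : ℕ) → GaugeField (F.P K) (k + 1) (Matrix.specialUnitaryGroup (Fin 2) ℂ) →
      GaugeField (F.P K) 0 (Matrix.specialUnitaryGroup (Fin 2) ℂ))
    (UkH : (k : ℕ) → Hist (F.P K) k → GaugeField (F.P K) k (Matrix.specialUnitaryGroup (Fin 2) ℂ) →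
      GaugeField (F.P K) 0 (Matrix.specialUnitaryGroup (Fin 2) ℂ))
    (hU0 : ∀ V : GaugeField (F.P K) 0 (Matrix.specialUnitaryGroup (Fin 2) ℂ), UkH 0 (Hist.triv (F.P K) 0) V = V)
    (hUs : ∀ (k : ℕ) (V : GaugeField (F.P K) (k + 1) (Matrix.specialUnitaryGroup (Fin 2) ℂ)), UkH (k + 1) (Hist.triv (F.P K) (k + 1)) V = Uk k V) :
    ExternalInputsAC (T3Scales F γ hγ hγ1 K) (Matrix.specialUnitaryGroup (Fin 2) ℂ) where
  av := avT3 F K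
  av_ac := avgAC_avT3 F K
  reg := reg
  Uk := Uk
  UkH := UkH
  UkH_triv := fun k V => by
    cases k with
    | zero => exact hU0 V
    | succ k => exact hUs k V

/-- The pinned inputs average by `avT3` (definitional). [folklore] -/
theorem XT3_av (reg : ℕ → Set (GaugeField (F.P K) 0 (Matrix.specialUnitaryGroup (Fin 2) ℂ)))
    (Uk : (k : ℕ) → GaugeField (F.P K) (k + 1) (Matrix.specialUnitaryGroup (Fin 2) ℂ) →
      GaugeField (F.P K) 0 (Matrix.specialUnitaryGroup (Fin 2) ℂ))
    (UkH : (k : ℕ) → Hist (F.P K) k → GaugeField (F.P K) k (Matrix.specialUnitaryGroup (Fin 2) ℂ) →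
      GaugeField (F.P K) 0 (Matrix.specialUnitaryGroup (Fin 2) ℂ))
    (hU0 : ∀ V : GaugeField (F.P K) 0 (Matrix.specialUnitaryGroup (Fin 2) ℂ), UkH 0 (Hist.triv (F.P K) 0) V = V)
    (hUs : ∀ (k : ℕ) (V : GaugeField (F.P K) (k + 1) (Matrix.specialUnitaryGroup (Fin 2) ℂ)), UkH (k + 1) (Hist.triv (F.P K) (k + 1)) V = Uk k V) :
    (XT3 F γ hγ hγ1 K reg Uk UkH hU0 hUs).av = avT3 F K := rfl

/-! ## §3 The package -/

/-- `(min γ₀ 1)² ≤ 1`: the lane's coupling window lies inside the family's standing smallness `γ ≤ 1`. [folklore] -/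
theorem sq_min_one_le (a : ℝ) (ha : 0 < a) : (min a 1) ^ 2 ≤ 1 := by
  have h0 : 0 ≤ min a 1 := le_min ha.le zero_le_one
  have h1 : min a 1 ≤ 1 := min_le_right _ _
  nlinarith

/-- **(α) AT THE T³ OBJECTS, ONE FAMILY** — for the family `F` and one primitive-constants record `𝔠` (group `SU(2)`, model `suGroupModel 2`):
for every coupling `γ ∈ (0, (min 𝔠.γ₀ 1)²]` (the lane's `≤`-window «g_k in a bounded set», p.257 L1) and every `K`, there are minimizer data
(`reg`, `U_k`, `U_k(·,h)` of [7]), expansion data `𝔖` (chart values in `𝔰𝔲(2)ᶜ`, on the lane's big-block carriers) and auxiliary data `𝔄` such that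
the AC (α) rows `AlphaAC.RunAlphaAC` hold for the PINNED inputs `XT3` (averaging `blockAvg ℰp`, Haar compatibility weakened to the theorem `AvgAC`,
masses the exact transports) — the lane's countersigned input list (GAP binders G3D-01…08, displays (26), (28), (44), (67), (68), [B1] (3.24),
identifications, data regularity, residuals R3D-01/02 in AC form) VERBATIM at the AC tower.  HYPOTHESIS SCHEMA (never asserted).
[cite: Balaban1985UV3, Thm 1 p.257 + Thm 2 p.272 + (41) p.266 + (47) p.267] -/
def AlphaInputsT3AC.Of (F : T3Family) (𝔠 : AlphaConsts F.L (suGroupModel 2).N) : Prop :=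
  ∀ (γ : ℝ) (hγ : 0 < γ) (hγ1 : γ ≤ (min 𝔠.gamma0 1) ^ 2) (K : ℕ),
    ∃ (reg : ℕ → Set (GaugeField (F.P K) 0 (Matrix.specialUnitaryGroup (Fin 2) ℂ)))
      (Uk : (k : ℕ) → GaugeField (F.P K) (k + 1) (Matrix.specialUnitaryGroup (Fin 2) ℂ) →
        GaugeField (F.P K) 0 (Matrix.specialUnitaryGroup (Fin 2) ℂ))
      (UkH : (k : ℕ) → Hist (F.P K) k → GaugeField (F.P K) k (Matrix.specialUnitaryGroup (Fin 2) ℂ) →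
        GaugeField (F.P K) 0 (Matrix.specialUnitaryGroup (Fin 2) ℂ))
      (hU0 : ∀ V : GaugeField (F.P K) 0 (Matrix.specialUnitaryGroup (Fin 2) ℂ), UkH 0 (Hist.triv (F.P K) 0) V = V)
      (hUs : ∀ (k : ℕ) (V : GaugeField (F.P K) (k + 1) (Matrix.specialUnitaryGroup (Fin 2) ℂ)),
        UkH (k + 1) (Hist.triv (F.P K) (k + 1)) V = Uk k V)
      (𝔖 : ∀ k, StepSeries (T3Scales F γ hγ (hγ1.trans (sq_min_one_le _ 𝔠.gamma0_pos)) K)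
        (Matrix.specialUnitaryGroup (Fin 2) ℂ) ↥(lieC (suGroupModel 2))
        (nblkOf (T3Scales F γ hγ (hγ1.trans (sq_min_one_le _ 𝔠.gamma0_pos)) K) 𝔠.lane.carrier k) k)
      (𝔄 : AlphaDataAC (suGroupModel 2) 𝔠
        (XT3 F γ hγ (hγ1.trans (sq_min_one_le _ 𝔠.gamma0_pos)) K reg Uk UkH hU0 hUs) 𝔖),
      RunAlphaAC (suGroupModel 2) 𝔠 (XT3 F γ hγ (hγ1.trans (sq_min_one_le _ 𝔠.gamma0_pos)) K reg Uk UkH hU0 hUs) 𝔖 𝔄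

/-- **`AlphaInputsT3AC L`** — Bałaban's (α) input package READ AT THE T³ OBJECTS for block size `L`: ONE primitive-constants record serves every
three-torus family of block size `L` (uniformity in the family and in `K`; the record is transported along `F.L = L`).  The closed proposition a
route item can name; OPEN (an input package, never asserted).  Its consequences for the cruxes of route `UnitScaleTilt` ((41)/(47) with large-field
histories and the small factors (71) for the `blockAvg ℰp`-averaged densities) are the feed theorems of `Balaban3D/Proofs/Thm2AC` through
`rho_towerOfAC_ae_eq_towerDensity` below. [cite: Balaban1985UV3, Thm 1 p.257 + Thm 2 p.272] -/
def AlphaInputsT3AC (L : ℕ) : Prop :=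
  ∃ 𝔠 : AlphaConsts L (suGroupModel 2).N, ∀ (F : T3Family) (hF : F.L = L), AlphaInputsT3AC.Of F (hF ▸ 𝔠)

/-- Unfolding lemma. -/
theorem alphaInputsT3AC_iff (L : ℕ) :
    AlphaInputsT3AC L ↔ ∃ 𝔠 : AlphaConsts L (suGroupModel 2).N, ∀ (F : T3Family) (hF : F.L = L), AlphaInputsT3AC.Of F (hF ▸ 𝔠) :=
  Iff.rfl

/-- Instantiation at a family of the given block size (the cast disappears: `F.L` IS the block size). -/
theorem AlphaInputsT3AC.of_family {F : T3Family} (h : AlphaInputsT3AC F.L) : ∃ 𝔠 : AlphaConsts F.L (suGroupModel 2).N, AlphaInputsT3AC.Of F 𝔠 := by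
  obtain ⟨𝔠, h𝔠⟩ := h
  exact ⟨𝔠, h𝔠 F rfl⟩

/-! ## §4 Why the socket is load-bearing: the AC tower's densities ARE the T³ cell's Radon–Nikodym tower, `dV`-a.e. -/

section Bridge

variable {F γ hγ hγ1 K}

/-- **The lane's Wilson start at `T3Scales` IS `e^{−E}` times the family's Boltzmann weight** `e^{−β_K A}` (`Missing.boltzmann`; same action
`wilsonAction4`, `1/g₀² = β_K`). [cite: Balaban1985UV3, (1) p.256] -/
theorem wilsonStart_T3_eq (E : ℝ) :
    wilsonStart (T3Scales F γ hγ hγ1 K).P (Matrix.specialUnitaryGroup (Fin 2) ℂ) (T3Scales F γ hγ hγ1 K).g0sq E =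
      fun U => Real.exp (-E) * boltzmann (F.P K) ((F.scheme ℰp γ).β K) U := by
  funext U
  show Real.exp (-(1 / (T3Scales F γ hγ hγ1 K).g0sq) * wilsonAction4 U - E) =
    Real.exp (-E) * Real.exp (-((F.scheme ℰp γ).β K) * wilsonAction4 U)
  rw [T3Scales_inv_g0sq_eq, ← Real.exp_add]
  congr 1
  ring

/-- **THE PLAIN ITERATED RN VERSION OVER THE PINNED AVERAGING IS THE T³ CELL'S TOWER**: `Carriers.rhoSeq (avT3 F K) ρ₀ k = towerDensity F K ρ₀ k` for
`k ≤ m + K` and EVERY initial density (both iterate `rnTransport (blockAvg ℰp)`; pointwise, by induction). [cite: Balaban1985UV3, (2) p.256] -/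
theorem rhoSeq_avT3_eq_towerDensity (ρ₀ : Density (F.P K) 0 (Matrix.specialUnitaryGroup (Fin 2) ℂ)) :
    ∀ k : ℕ, k ≤ F.m + K → rhoSeq (avT3 F K) ρ₀ k = towerDensity F K ρ₀ k
  | 0, _ => rfl
  | k + 1, hk => by
    rw [rhoSeq_succ, towerDensity_succ F K ρ₀ hk, rhoSeq_avT3_eq_towerDensity ρ₀ k (by omega), avT3_of_le F K hk]
    rfl

/-- **THE AC TOWER'S DENSITIES ARE THE T³ TOWER FROM THE WILSON START, `dV`-a.e.** — for ANY constants record `K₀`, AC inputs with the pinned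
averaging (`X.av = avT3 F K`, e.g. `XT3 …`) and expansion data `𝔖`: for `k ≤ m + K`, the density `ρ_k` of the lane's AC tower
`towerOfAC K₀ X 𝔖` (version-selected RN transport, ruling R-RN) equals `dV`-almost everywhere the T³ cell's `towerDensity F K ρ₀ k` from
`ρ₀ = e^{−E}·e^{−β_K A}` (`E` the tower's (62)/(64) constant) — `TowerAC.tower3_rho_ae_eq_rhoSeq` (honesty of the selection) +
`rhoSeq_avT3_eq_towerDensity` + `wilsonStart_T3_eq`.  Through `T3RestrictedUnitDensity.integral_towerDensity_mul` this is the law of the `k`-fold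
block-averaged Gibbs field — the object of `HistoryTailAt`. [cite: Balaban1985UV3, (2) p.256 + (41) p.266] -/
theorem rho_towerOfAC_ae_eq_towerDensity (K₀ : Balaban3D.Proofs.Inputs.LaneConsts F.L) {V : Type} [NormedAddCommGroup V] [NormedSpace ℂ V]
    (X : ExternalInputsAC (T3Scales F γ hγ hγ1 K) (Matrix.specialUnitaryGroup (Fin 2) ℂ)) (hX : X.av = avT3 F K)
    (𝔖 : ∀ k, StepSeries (T3Scales F γ hγ hγ1 K) (Matrix.specialUnitaryGroup (Fin 2) ℂ) V (nblkOf (T3Scales F γ hγ hγ1 K) K₀.carrier k) k)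
    (k : ℕ) (hk : k ≤ F.m + K) :
    (towerOfAC K₀ X 𝔖).ρ k =ᵐ[fieldMeasure (F.P K) k (Matrix.specialUnitaryGroup (Fin 2) ℂ)]
      towerDensity F K (fun U => Real.exp (-(B10.Ek (inputOfAC K₀ X 𝔖).Estep K 0)) * boltzmann (F.P K) ((F.scheme ℰp γ).β K) U) k := by
  have h1 := (inputOfAC K₀ X 𝔖).tower3_rho_ae_eq_rhoSeq k
  rw [wilsonStart_T3_eq] at h1
  have hav : (inputOfAC K₀ X 𝔖).av = avT3 F K := hX
  rw [hav] at h1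
  exact h1.trans (Filter.EventuallyEq.of_eq (rhoSeq_avT3_eq_towerDensity _ k hk))

end Bridge

end Summit.QuantumFields.YangMills.Theorems

end
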